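import Literature.Geometry.Kaehler.ComplexTorusHomologyPontryaginBasis
import Literature.Geometry.Kaehler.ComplexTorusFirstCohomologyLatticeDual
import Literature.AlgebraicTopology.SingularHomology.TorusPontryaginAnticommutative
import HarnessLib

/-!
# The Pontryagin ring of a complex torus on SINGULAR homology: associativity, `σ ⋆ τ = (-1)^{pq} τ ⋆ σ`
# (Lange 2023, Lemma 2.5.11) and "the Pontryagin product is dual to the cup product" (Prop. 2.5.13)

Topic `Literature/Geometry/Kaehler` (complex tori `X = E/Φ(ℤ^ι)`, `Literature.Geometry.Kaehler.ComplexTorus`).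
The torus-side theorems of `TorusPontryaginProductStructure.lean` / `TorusPontryaginAnticommutative.lean`
(for `(ℝ/ℤ)ⁿ`) transported along the additive homeomorphism `toTorus Φ : X ≃ₜ (ℝ/ℤ)^{|ι|}`, for the
GENUINE singular-homology Pontryagin product `⋆ = μ_* ∘ ×` (`singularHomology.addPontryagin`) and the
singular cup product — the singular-(co)homology carrier of the lane's model `H_p(X, ℤ) := ⋀ᵖ Λ`
(`ComplexTorusPontryaginProduct.lean`). The MODEL-side duality map (`D` from `⋀ᵖ Λ` to the integral
invariant `p`-forms, `dualityD`, with `dualityD_pontryagin`) is `ComplexTorusPontryaginDuality.lean`; the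
present file is its singular counterpart (`latticeDual` below lands in singular cohomology `Hᵏ⁺¹(X; ℤ)`),
and `ComplexTorusHomologyExteriorModel.lean` identifies singular homology with the model.
-- TODO(comparison square): `latticeDual = (de Rham/period comparison)⁻¹ ∘ dualityD ∘ homologyModelEquiv`
-- needs the cup-versus-wedge compatibility of the period isomorphism in all degrees.

* `addPontryagin_latticePontryaginMonomial`: **`λ_I ⋆ λ_J = λ_{IJ}`** for the lattice monomials
  `h(λ_{e 0}) ⋆ ⋯ ⋆ h(λ_{e k})`; `latticePontryaginMonomial_eq_zero_of_not_injective` (repeated circle ⇒ 0);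
  `latticePontryaginMonomial_comp_perm` (`λ_{w∘σ} = sign σ · λ_w`);
* `addPontryagin_assoc`: **`(σ ⋆ τ) ⋆ υ = σ ⋆ (τ ⋆ υ)`** on `H_{≥1}(X; ℤ)` (Exercise 1.1.6 (11)(b)(ii));
* `addPontryagin_comm`: **`σ ⋆ τ = (-1)^{pq} τ ⋆ σ`** (Lemma 2.5.11; Exercise 1.1.6 (11)(b)(iii)), and
  `addPontryagin_hOneBasis_comm`: `h(λ_a) ⋆ h(λ_b) = -h(λ_b) ⋆ h(λ_a)`;
* `latticeDual Φ k : Hₖ₊₁(X; ℤ) ≃ₗ[ℤ] Hᵏ⁺¹(X; ℤ)` — Lange's **`D : H_p(X, ℤ) → Hᵖ(X, ℤ)`, `λ_I ↦ dx_I`**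
  (p. 134), with `latticeDual_latticePontryaginMonomial`: `D(h(λ_{w 0}) ⋆ ⋯ ⋆ h(λ_{w k})) = ξ_{w 0} ⌣ ⋯ ⌣ ξ_{w k}`
  for EVERY word `w` (`ξ_b = coordClass Φ ℤ b`, the class of `dx_b`), the duality
  `⟨D λ_s, λ_t⟩ = δ_{st}` (Lemma 2.5.12), and **Prop. 2.5.13** `latticeDual_addPontryagin`:
  **`D(σ ⋆ τ) = D σ ⌣ D τ`**;
* `singularCohomologyIntBasis_eq_cupMonomial_coordClass`: the tree's transported basis of `Hᵏ(X; ℤ)` IS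
  the family of cup monomials `ξ_{i₀} ⌣ ⋯ ⌣ ξ_{i_{k-1}}` of the coordinate classes.

Words with letters in `ι` are numbered through `f = Fintype.equivFin ι` wherever the torus-side word
calculus (`cupMonomial`, `appendWord`, values in `Fin n`) is used.

Everything is proved; the only definition (with body) is `latticeDual`; no named fact.

## References

* [Lange2023AbelianVarietiesComplex] H. Lange, *Abelian Varieties over the Complex Numbers* (2023),
  §2.5.3 pp. 132–134 (Lemma 2.5.11, Lemma 2.5.12, Prop. 2.5.13, diagram (2.9)); Exercise 1.1.6 (11)–(12).
* [HatcherAT2002] A. Hatcher, *Algebraic Topology* (2002), §3.2 Example 3.16, §3.B, §3.C.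
-/

noncomputable section

open CategoryTheory Module
open Literature.AlgebraicTopology.SingularHomology Literature.AlgebraicTopology

universe u

namespace Literature.Geometry.Kaehler

namespace ComplexTorus

variable {ι : Type} [Fintype ι] [DecidableEq ι] {E : Type} [NormedAddCommGroup E] [NormedSpace ℂ E]
variable (Φ : (ι → ℝ) ≃L[ℝ] E)

/-! ### Transport of words and cohomology classes along `toTorus` -/

omit [DecidableEq ι] in
/-- `p_{f b} ∘ toTorus = eval_b`. [cite: Lange2023AbelianVarietiesComplex, §1.1.1 (PDF p. 16)] -/
theorem torusProj_comp_toTorus (b : ι) :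
    (torusProj (Fintype.card ι) (Fintype.equivFin ι b)).comp (toTorus Φ : C(ComplexTorus Φ, Torus (Fintype.card ι))) =
      (ContinuousMap.eval b : C(ComplexTorus Φ, AddCircle (1 : ℝ))) := by
  ext x : 1
  exact toTorus_apply_equivFin Φ x b

omit [DecidableEq ι] in
/-- **`(toTorus)^* ξ_{f b} = ξ_b`**: the pulled-back coordinate class is the coordinate class `coordClass Φ ℤ b`
(the class of `dx_b`). [cite: Lange2023AbelianVarietiesComplex, §1.1.4 Prop. 1.1.20] -/
theorem map_toTorus_torusXi (b : ι) :
    singularCohomology.map ℤ ℤ (toTorus Φ : C(ComplexTorus Φ, Torus (Fintype.card ι))) 1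
        (torusXi ℤ (Fintype.card ι) (Fintype.equivFin ι b)) = coordClass Φ ℤ b := by
  rw [torusXi, ← ModuleCat.comp_apply, ← singularCohomology.map_comp, torusProj_comp_toTorus]
  rfl

omit [DecidableEq ι] in
/-- **`(toTorus)^* (ξ_{u₀} ⌣ ⋯ ⌣ ξ_{u_{d-1}}) = ξ_{f⁻¹ u₀} ⌣ ⋯ ⌣ ξ_{f⁻¹ u_{d-1}}`**: the cup monomials of the
coordinate classes of `X` (numbered by `f = Fintype.equivFin ι`). [cite: HatcherAT2002, §3.2 Example 3.16] -/
theorem map_toTorus_torusMonomial (d : ℕ) (u : Fin d → Fin (Fintype.card ι)) :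
    singularCohomology.map ℤ ℤ (toTorus Φ : C(ComplexTorus Φ, Torus (Fintype.card ι))) d
        (torusMonomial ℤ (Fintype.card ι) d u) =
      cupMonomial (fun j ↦ coordClass Φ ℤ ((Fintype.equivFin ι).symm j)) d u := by
  rw [torusMonomial, map_cupMonomial]
  congr 1
  funext j
  rw [← map_toTorus_torusXi Φ ((Fintype.equivFin ι).symm j), Equiv.apply_symm_apply]

omit [DecidableEq ι] in
/-- The inverse comparison isomorphism on cohomology is `(toTorus)^*`. [cite: Lange2023AbelianVarietiesComplex, §1.1.3 Lemma 1.1.17 (PDF p. 23)] -/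
theorem singularCohomologyIntEquiv_symm_apply (k : ℕ) (y : singularCohomology ℤ ℤ (Torus (Fintype.card ι)) k) :
    (singularCohomologyIntEquiv Φ k).symm y =
      singularCohomology.map ℤ ℤ (toTorus Φ : C(ComplexTorus Φ, Torus (Fintype.card ι))) k y := rfl

omit [DecidableEq ι] in
/-- **The transported integral basis of `Hᵏ(X; ℤ)` consists of the cup monomials of the coordinate classes**:
`singularCohomologyIntBasis Φ k t = ξ_{f⁻¹ t₀} ⌣ ⋯ ⌣ ξ_{f⁻¹ t_{k-1}}`. [cite: Lange2023AbelianVarietiesComplex, §1.1.3 Exercise 1.1.6 (8) (PDF p. 27)] -/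
theorem singularCohomologyIntBasis_eq_cupMonomial_coordClass (k : ℕ) (t : Set.powersetCard (Fin (Fintype.card ι)) k) :
    singularCohomologyIntBasis Φ k t =
      cupMonomial (fun j ↦ coordClass Φ ℤ ((Fintype.equivFin ι).symm j)) k (subsetEmb t) := by
  rw [singularCohomologyIntBasis_eq_map, map_toTorus_torusMonomial]

/-! ### The algebra of lattice monomials -/

omit [DecidableEq ι] in
/-- `(toTorus)_*` is injective on `Hₖ₊₁`. [cite: Lange2023AbelianVarietiesComplex, §1.1.3 Exercise 1.1.6 (8) (held p0027 L13)] -/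
theorem map_toTorus_injective (k : ℕ) :
    Function.Injective (singularHomology.map ℤ ℤ (toTorus Φ : C(ComplexTorus Φ, Torus (Fintype.card ι))) (k + 1)) :=
  (singularHomologyIntEquiv Φ k).injective

/-- **`λ_I ⋆ λ_J = λ_{IJ}` on `X`**: the Pontryagin product of two lattice monomials is the monomial of the
concatenated word (words in `ι` are concatenated through the numbering `f = Fintype.equivFin ι`).
[cite: Lange2023AbelianVarietiesComplex, §2.5.3 Lemma 2.5.12 (held p0133); Exercise 1.1.6 (11)(b)(ii)] -/
theorem addPontryagin_latticePontryaginMonomial {k l m : ℕ} (h : k + 1 + (l + 1) = m + 1) (e : Fin (k + 1) → ι)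
    (e' : Fin (l + 1) → ι) :
    singularHomology.addPontryagin ℤ (ComplexTorus Φ) h (latticePontryaginMonomial Φ k e) (latticePontryaginMonomial Φ l e') =
      latticePontryaginMonomial Φ m
        ((Fintype.equivFin ι).symm ∘ appendWord (Fintype.equivFin ι ∘ e) (Fintype.equivFin ι ∘ e') m h) := by
  apply map_toTorus_injective Φ m
  rw [singularHomology.map_addPontryagin (toTorus Φ : C(ComplexTorus Φ, Torus (Fintype.card ι))) (toTorus_add Φ),
    map_toTorus_latticePontryaginMonomial, map_toTorus_latticePontryaginMonomial, map_toTorus_latticePontryaginMonomial,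
    addPontryagin_pontryaginMonomial h]
  congr 1
  funext i
  simp

/-- **A lattice monomial with a repeated circle vanishes** (`h(λ_a) ⋆ h(λ_a) = 0`, exterior algebra).
[cite: Lange2023AbelianVarietiesComplex, §2.5.3 Lemma 2.5.11 (held p0132–p0133); Exercise 1.1.6 (11)(b)(iii)] -/
theorem latticePontryaginMonomial_eq_zero_of_not_injective {d : ℕ} {w : Fin (d + 1) → ι} (hw : ¬Function.Injective w) :
    latticePontryaginMonomial Φ d w = 0 := by
  apply map_toTorus_injective Φ d
  rw [map_toTorus_latticePontryaginMonomial, map_zero,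
    pontryaginMonomial_eq_zero_of_not_injective fun h ↦ hw (Function.Injective.of_comp h)]

/-- **Permuting the circles: `λ_{w∘σ} = sign σ · λ_w`** on `X`. [cite: Lange2023AbelianVarietiesComplex, §2.5.3 Lemma 2.5.11 (held p0132–p0133)] -/
theorem latticePontryaginMonomial_comp_perm {d : ℕ} (w : Fin (d + 1) → ι) (σ : Equiv.Perm (Fin (d + 1))) :
    latticePontryaginMonomial Φ d (w ∘ σ) = ((Equiv.Perm.sign σ : ℤˣ) : ℤ) • latticePontryaginMonomial Φ d w := by
  apply map_toTorus_injective Φ d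
  rw [map_toTorus_latticePontryaginMonomial, map_zsmul, map_toTorus_latticePontryaginMonomial, ← Function.comp_assoc,
    pontryaginMonomial_comp_perm]

omit [DecidableEq ι] in
/-- **Associativity of the Pontryagin product on `H_{≥1}(X; ℤ)`** (Exercise 1.1.6 (11)(b)(ii)).
[cite: Lange2023AbelianVarietiesComplex, Exercise 1.1.6 (11)(b)(ii) (held p0028)] -/
theorem addPontryagin_assoc {a b c m s t : ℕ} (h₁ : a + 1 + (b + 1) = m + 1) (h₂ : m + 1 + (c + 1) = s + 1)
    (h₃ : b + 1 + (c + 1) = t + 1) (h₄ : a + 1 + (t + 1) = s + 1) (x : singularHomology ℤ ℤ (ComplexTorus Φ) (a + 1))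
    (y : singularHomology ℤ ℤ (ComplexTorus Φ) (b + 1)) (z : singularHomology ℤ ℤ (ComplexTorus Φ) (c + 1)) :
    singularHomology.addPontryagin ℤ (ComplexTorus Φ) h₂ (singularHomology.addPontryagin ℤ (ComplexTorus Φ) h₁ x y) z =
      singularHomology.addPontryagin ℤ (ComplexTorus Φ) h₄ x (singularHomology.addPontryagin ℤ (ComplexTorus Φ) h₃ y z) := by
  apply map_toTorus_injective Φ s
  simp only [singularHomology.map_addPontryagin (toTorus Φ : C(ComplexTorus Φ, Torus (Fintype.card ι))) (toTorus_add Φ)]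
  exact Literature.AlgebraicTopology.SingularHomology.addPontryagin_assoc h₁ h₂ h₃ h₄ _ _ _

omit [DecidableEq ι] in
/-- **Lemma 2.5.11 on `X`: `σ ⋆ τ = (-1)^{pq} τ ⋆ σ`** for `σ ∈ Hₚ(X; ℤ)`, `τ ∈ H_q(X; ℤ)` (`p = k + 1`,
`q = l + 1`). [cite: Lange2023AbelianVarietiesComplex, §2.5.3 Lemma 2.5.11 (pp. 132–133)] -/
theorem addPontryagin_comm {k l m : ℕ} (h : k + 1 + (l + 1) = m + 1) (h' : l + 1 + (k + 1) = m + 1)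
    (x : singularHomology ℤ ℤ (ComplexTorus Φ) (k + 1)) (y : singularHomology ℤ ℤ (ComplexTorus Φ) (l + 1)) :
    singularHomology.addPontryagin ℤ (ComplexTorus Φ) h x y =
      ((-1 : ℤ) ^ ((k + 1) * (l + 1))) • singularHomology.addPontryagin ℤ (ComplexTorus Φ) h' y x := by
  apply map_toTorus_injective Φ m
  rw [map_zsmul]
  simp only [singularHomology.map_addPontryagin (toTorus Φ : C(ComplexTorus Φ, Torus (Fintype.card ι))) (toTorus_add Φ)]
  exact Literature.AlgebraicTopology.SingularHomology.addPontryagin_comm h h' _ _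

/-- **`h(λ_a) ⋆ h(λ_b) = -(h(λ_b) ⋆ h(λ_a))`** in `H₂(X; ℤ)`. [cite: Lange2023AbelianVarietiesComplex, §2.5.3 Lemma 2.5.11 (pp. 132–133); Exercise 1.1.6 (11)(b)(iii)] -/
theorem addPontryagin_hOneBasis_comm (a b : ι) :
    singularHomology.addPontryagin ℤ (ComplexTorus Φ) rfl (hOneBasis Φ ℤ a) (hOneBasis Φ ℤ b) =
      -singularHomology.addPontryagin ℤ (ComplexTorus Φ) rfl (hOneBasis Φ ℤ b) (hOneBasis Φ ℤ a) := by
  apply map_toTorus_injective Φ 1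
  rw [map_neg, singularHomology.map_addPontryagin (toTorus Φ : C(ComplexTorus Φ, Torus (Fintype.card ι))) (toTorus_add Φ),
    singularHomology.map_addPontryagin (toTorus Φ : C(ComplexTorus Φ, Torus (Fintype.card ι))) (toTorus_add Φ),
    map_toTorus_hOneBasis, map_toTorus_hOneBasis, addPontryagin_torusLambda_comm]

/-- **`h(λ_a) ⋆ h(λ_a) = 0`** in `H₂(X; ℤ)`. [cite: Lange2023AbelianVarietiesComplex, §2.5.3 Lemma 2.5.11 (pp. 132–133); Exercise 1.1.6 (11)(b)(iii)] -/
theorem addPontryagin_hOneBasis_self (a : ι) :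
    singularHomology.addPontryagin ℤ (ComplexTorus Φ) rfl (hOneBasis Φ ℤ a) (hOneBasis Φ ℤ a) = 0 := by
  have h := latticePontryaginMonomial_eq_zero_of_not_injective Φ (d := 1) (w := ![a, a])
    (fun hi ↦ absurd (hi (show (![a, a] : Fin 2 → ι) 0 = (![a, a] : Fin 2 → ι) 1 from rfl)) (by decide))
  exact h

/-! ### The duality `D : λ_I ↦ dx_I` and Proposition 2.5.13 on `X` -/

/-- **Lange's `D : Hₖ₊₁(X, ℤ) → Hᵏ⁺¹(X, ℤ)`, `λ_I ↦ dx_I`, an isomorphism** (p. 134): here the composite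
`(toTorus)^* ∘ D_{(ℝ/ℤ)ⁿ} ∘ (toTorus)_*` of the torus duality `pontryaginDual` with the comparison isomorphisms.
[cite: Lange2023AbelianVarietiesComplex, §2.5.3 Prop. 2.5.13 (p. 134)] -/
def latticeDual (k : ℕ) : singularHomology ℤ ℤ (ComplexTorus Φ) (k + 1) ≃ₗ[ℤ] singularCohomology ℤ ℤ (ComplexTorus Φ) (k + 1) :=
  (singularHomologyIntEquiv Φ k).trans ((pontryaginDual (Fintype.card ι) k).trans (singularCohomologyIntEquiv Φ (k + 1)).symm)

omit [DecidableEq ι] in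
/-- Unfolding `D`. [cite: Lange2023AbelianVarietiesComplex, §2.5.3 Prop. 2.5.13 (p. 134)] -/
theorem latticeDual_apply (k : ℕ) (x : singularHomology ℤ ℤ (ComplexTorus Φ) (k + 1)) :
    latticeDual Φ k x = singularCohomology.map ℤ ℤ (toTorus Φ : C(ComplexTorus Φ, Torus (Fintype.card ι))) (k + 1)
      (pontryaginDual (Fintype.card ι) k
        (singularHomology.map ℤ ℤ (toTorus Φ : C(ComplexTorus Φ, Torus (Fintype.card ι))) (k + 1) x)) := rfl

/-- **`D(h(λ_{w 0}) ⋆ ⋯ ⋆ h(λ_{w k})) = ξ_{w 0} ⌣ ⋯ ⌣ ξ_{w k}` for EVERY word `w`** (`ξ_b = coordClass Φ ℤ b`).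
[cite: Lange2023AbelianVarietiesComplex, §2.5.3 Prop. 2.5.13 (p. 134)] -/
theorem latticeDual_latticePontryaginMonomial (k : ℕ) (w : Fin (k + 1) → ι) :
    latticeDual Φ k (latticePontryaginMonomial Φ k w) =
      cupMonomial (fun j ↦ coordClass Φ ℤ ((Fintype.equivFin ι).symm j)) (k + 1) (Fintype.equivFin ι ∘ w) := by
  rw [latticeDual_apply, map_toTorus_latticePontryaginMonomial, pontryaginDual_pontryaginMonomial, map_toTorus_torusMonomial]

/-- `D` carries the homology basis to the cohomology basis: `D(singularHomologyIntBasis Φ k s) =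
singularCohomologyIntBasis Φ (k+1) s`. [cite: Lange2023AbelianVarietiesComplex, §2.5.3 Lemma 2.5.12, Prop. 2.5.13 (pp. 133–134)] -/
theorem latticeDual_singularHomologyIntBasis (k : ℕ) (s : Set.powersetCard (Fin (Fintype.card ι)) (k + 1)) :
    latticeDual Φ k (singularHomologyIntBasis Φ k s) = singularCohomologyIntBasis Φ (k + 1) s := by
  rw [singularHomologyIntBasis_apply, latticeDual_latticePontryaginMonomial, singularCohomologyIntBasis_eq_cupMonomial_coordClass]
  congr 1
  funext j
  simp

/-- **Lemma 2.5.12 (duality): `⟨D λ_s, λ_t⟩ = δ_{st}`** — the basis `{D λ_I} = {dx_I}` of `Hᵏ⁺¹(X; ℤ)` is dual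
to the basis `{λ_I}` of `Hₖ₊₁(X; ℤ)`. [cite: Lange2023AbelianVarietiesComplex, §2.5.3 Lemma 2.5.12 (p. 133)] -/
theorem kroneckerPairing_latticeDual_singularHomologyIntBasis (k : ℕ)
    [DecidableEq (Set.powersetCard (Fin (Fintype.card ι)) (k + 1))] (s t : Set.powersetCard (Fin (Fintype.card ι)) (k + 1)) :
    kroneckerPairing ℤ ℤ (ComplexTorus Φ) (k + 1) (latticeDual Φ k (singularHomologyIntBasis Φ k s))
      (singularHomologyIntBasis Φ k t) = if s = t then 1 else 0 := by
  rw [latticeDual_singularHomologyIntBasis, kroneckerPairing_singularCohomologyIntBasis_singularHomologyIntBasis]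

omit [DecidableEq ι] in
/-- **Proposition 2.5.13 on `X`: "The Pontryagin product in homology is dual to the cup product in
cohomology"** — `D(σ ⋆ τ) = D σ ⌣ D τ` (diagram (2.9)). [cite: Lange2023AbelianVarietiesComplex, §2.5.3 Prop. 2.5.13 and (2.9) (p. 134)] -/
theorem latticeDual_addPontryagin {k l m : ℕ} (h : k + 1 + (l + 1) = m + 1) (x : singularHomology ℤ ℤ (ComplexTorus Φ) (k + 1))
    (y : singularHomology ℤ ℤ (ComplexTorus Φ) (l + 1)) :
    latticeDual Φ m (singularHomology.addPontryagin ℤ (ComplexTorus Φ) h x y) =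
      cupProduct h (latticeDual Φ k x) (latticeDual Φ l y) := by
  rw [latticeDual_apply, latticeDual_apply, latticeDual_apply,
    singularHomology.map_addPontryagin (toTorus Φ : C(ComplexTorus Φ, Torus (Fintype.card ι))) (toTorus_add Φ),
    pontryaginDual_addPontryagin, cupProduct_map]

end ComplexTorus

end Literature.Geometry.Kaehler

end
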